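import Summits.Ventures.Crystal3D.Theorems.StickyWulffConstantGenericWallFloorRayTerraceA
import HarnessLib

/-!
# The forced ray with TIES: one push lands on SOME lowest member of the rising triple (crux `GenericWallFloor`,
# stmt-Ventures-19480, line `WallLedgerG`; milestone M1 of the in-kernel tail datum, cf-p1 (lxxxvi))

HONEST FRAMING. Venture `Summits/Ventures/Crystal3D` (cell `crystal3d-full`), helper `--supports` the crux `GenericWallFloor`
(stmt-Ventures-19480) of `route-Ventures-StickyWulffConstant`, REGISTERED line `WallLedgerG`.  Rung credit only; F-C1 not moved;
census-free, standard axioms.  PURPOSE (cf-p1 DECISION (lxxxvi), M1 = «ray words computable»): the certificate of the uniform tail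
(ROCERT-g13 §4, kernel form `…TailSeparation{,Charge}`) lists, per box of wall normals, the 5-letter words of ALL forced rays of a steering
family INCLUDING TIE BRANCHES of the best capper.  `ray_push_cubic` (…RayPushCubic) describes one push only when the lowest member of the
rising triple is STRICTLY lowest; with ties the tree's `bestCapper` is an unspecified maximiser.  This file gives the tie-tolerant form,
so that a finite enumeration of ALL branches (the ℚ-mirror, sequel) provably contains the real ray:

* **`ray_push_cubic_weak`** — for a frame `F`, slot `v`, unit menu normal `p` (`⟪Fv, p⟫ = √(2/3)`), numerators `X = √2κ(Fv)`,
  `P = √3κ(p)`, steering `κ(z) = t·Zc` (`t > 0`): there is a member `Ys` of the rising triple `{X, (−X ± P×X + 2P)/2}` which is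
  `Zc`-LOWEST (`Zc·Ys ≤ Zc·Y` for all three members) such that the twin frame's best capper has numerator `(4/3)P − Ys` and the forced
  next normal `(5/3)P − 2Ys` (proof = `ray_push_cubic`'s, minus the uniqueness step).
* `forcedTop_succ_cubic_weak` / `forcedTop_zero_cubic_weak` — the same along a forced ray `forcedTop z ⟨A, u, 0⟩ n k`.
WHAT THIS IS NOT: no statement about packings or cells; not the stub; F-C1 not moved.
-/

noncomputable section

namespace Summit.Ventures.Crystal3D.Theorems

open Summit.Ventures.Crystal3D Finset Matrix
open scoped InnerProductSpace

/-- **ONE PUSH with ties.**  See the module docstring. -/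
theorem ray_push_cubic_weak (A F : EuclideanSpace ℝ (Fin 3) ≃ₗᵢ[ℝ] EuclideanSpace ℝ (Fin 3))
    {v p z : EuclideanSpace ℝ (Fin 3)} {X P Zc : Fin 3 → ℝ} {t : ℝ}
    (hv : v ∈ fccSlots) (hp : ‖p‖ = 1)
    (hmenu : ∀ w ∈ fccSlots, ⟪F w, p⟫_ℝ = 0 ∨ ⟪F w, p⟫_ℝ = Real.sqrt (2 / 3) ∨ ⟪F w, p⟫_ℝ = -Real.sqrt (2 / 3))
    (hpos : ⟪F v, p⟫_ℝ = Real.sqrt (2 / 3))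
    (hX : cubicCoords (A.symm (F v)) = (Real.sqrt 2)⁻¹ • X)
    (hP : cubicCoords (A.symm p) = (Real.sqrt 3)⁻¹ • P)
    (hZ : cubicCoords (A.symm z) = t • Zc) (ht : 0 < t) :
    ∃ Ys : Fin 3 → ℝ, (Ys = X ∨ Ys = (1 / 2 : ℝ) • (-X + P ⨯₃ X + (2 : ℝ) • P) ∨ Ys = (1 / 2 : ℝ) • (-X - P ⨯₃ X + (2 : ℝ) • P)) ∧
      (∀ Y : Fin 3 → ℝ, (Y = X ∨ Y = (1 / 2 : ℝ) • (-X + P ⨯₃ X + (2 : ℝ) • P) ∨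
        Y = (1 / 2 : ℝ) • (-X - P ⨯₃ X + (2 : ℝ) • P)) → Zc ⬝ᵥ Ys ≤ Zc ⬝ᵥ Y) ∧
      cubicCoords (A.symm (twinFrame F p (bestCapper (twinFrame F p) p z))) =
        (Real.sqrt 2)⁻¹ • ((4 / 3 : ℝ) • P - Ys) ∧
      cubicCoords (A.symm ((2 * Real.sqrt (2 / 3)) • twinFrame F p (bestCapper (twinFrame F p) p z) - p)) =
        (Real.sqrt 3)⁻¹ • ((5 / 3 : ℝ) • P - (2 : ℝ) • Ys) := by
  classical
  obtain ⟨hs2, hs3, hs2p, hs3p, h23⟩ := sqrt_two_three_facts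
  obtain ⟨h23sq, h45⟩ := sqrt_twoThirds_facts
  have hpp : ⟪p, p⟫_ℝ = 1 := by rw [real_inner_self_eq_norm_sq, hp, one_pow]
  have κi := inner_eq_cubic_symm A
  have κsub : ∀ x y : EuclideanSpace ℝ (Fin 3),
      cubicCoords (A.symm (x - y)) = cubicCoords (A.symm x) - cubicCoords (A.symm y) :=
    fun x y => by rw [map_sub, cubicCoords_sub]
  have κsmul : ∀ (r : ℝ) (x : EuclideanSpace ℝ (Fin 3)), cubicCoords (A.symm (r • x)) = r • cubicCoords (A.symm x) :=
    fun r x => by rw [LinearIsometryEquiv.map_smul, cubicCoords_smul]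
  obtain ⟨htrip, hreal⟩ := rising_triple A F hv hp hmenu hpos hX hP
  have hF' : ∀ x, twinFrame F p x = F x - (2 * ⟪F x, p⟫_ℝ) • p := twinFrame_apply F hp
  -- every member `Y` of the triple is realised by a rising slot `w`; `−w` is a positive slot of the twin frame
  have hcand : ∀ Y : Fin 3 → ℝ, (Y = X ∨ Y = (1 / 2 : ℝ) • (-X + P ⨯₃ X + (2 : ℝ) • P) ∨
      Y = (1 / 2 : ℝ) • (-X - P ⨯₃ X + (2 : ℝ) • P)) →
      ∃ w ∈ fccSlots, cubicCoords (A.symm (F w)) = (Real.sqrt 2)⁻¹ • Y ∧ -w ∈ fccSlots ∧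
        twinFrame F p (-w) = (2 * Real.sqrt (2 / 3)) • p - F w ∧ 0 < ⟪twinFrame F p (-w), p⟫_ℝ := by
    intro Y hY
    obtain ⟨w, hw, hwpos, hwc⟩ := hreal Y hY
    have hF'nw : twinFrame F p (-w) = (2 * Real.sqrt (2 / 3)) • p - F w := by
      rw [hF', map_neg, inner_neg_left, hwpos]; module
    refine ⟨w, hw, hwc, neg_mem_fccSlots hw, hF'nw, ?_⟩
    rw [hF'nw, inner_sub_left, real_inner_smul_left, hpp, hwpos]; linarith
  obtain ⟨wj, -, -, hnwj, -, hF'nwj_pos⟩ := hcand X (Or.inl rfl)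
  have hne : (fccSlots.filter fun q => 0 < ⟪twinFrame F p q, p⟫_ℝ).Nonempty :=
    ⟨-wj, Finset.mem_filter.2 ⟨hnwj, hF'nwj_pos⟩⟩
  -- the best capper
  obtain ⟨hqmem, hqmax⟩ := bestCapper_spec (twinFrame F p) p z hne
  rw [Finset.mem_filter] at hqmem
  obtain ⟨hq, hqpos⟩ := hqmem
  obtain ⟨hF'q, hrise_nq⟩ := twin_pos_slot F hp hmenu hq hqpos
  have hnq : -bestCapper (twinFrame F p) p z ∈ fccSlots := neg_mem_fccSlots hq
  obtain ⟨Ys, hYs⟩ : ∃ Y : Fin 3 → ℝ,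
      Y = Real.sqrt 2 • cubicCoords (A.symm (F (-bestCapper (twinFrame F p) p z))) := ⟨_, rfl⟩
  have hYs_def : cubicCoords (A.symm (F (-bestCapper (twinFrame F p) p z))) = (Real.sqrt 2)⁻¹ • Ys := by
    rw [hYs, smul_smul, inv_mul_cancel₀ hs2p.ne', one_smul]
  have hYsT : Ys = X ∨ Ys = (1 / 2 : ℝ) • (-X + P ⨯₃ X + (2 : ℝ) • P) ∨
      Ys = (1 / 2 : ℝ) • (-X - P ⨯₃ X + (2 : ℝ) • P) := by rw [hYs]; exact htrip _ hnq hrise_nq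
  -- maximality of the best capper = minimality of `Ys` over the triple
  have hle : ∀ Y : Fin 3 → ℝ, (Y = X ∨ Y = (1 / 2 : ℝ) • (-X + P ⨯₃ X + (2 : ℝ) • P) ∨
      Y = (1 / 2 : ℝ) • (-X - P ⨯₃ X + (2 : ℝ) • P)) → Zc ⬝ᵥ Ys ≤ Zc ⬝ᵥ Y := by
    intro Y hY
    obtain ⟨w, hw, hwc, hnw, hF'nw, hF'nw_pos⟩ := hcand Y hY
    have hmax := hqmax (-w) (Finset.mem_filter.2 ⟨hnw, hF'nw_pos⟩)
    rw [hF'q, hF'nw, inner_sub_left, inner_sub_left] at hmax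
    have h1 : ⟪F (-bestCapper (twinFrame F p) p z), z⟫_ℝ ≤ ⟪F w, z⟫_ℝ := by linarith
    have e1 : ⟪F (-bestCapper (twinFrame F p) p z), z⟫_ℝ = ((Real.sqrt 2)⁻¹ * t) * (Zc ⬝ᵥ Ys) := by
      rw [κi, hYs_def, hZ, smul_dotProduct, dotProduct_smul, smul_eq_mul, smul_eq_mul, dotProduct_comm]; ring
    have e2 : ⟪F w, z⟫_ℝ = ((Real.sqrt 2)⁻¹ * t) * (Zc ⬝ᵥ Y) := by
      rw [κi, hwc, hZ, smul_dotProduct, dotProduct_smul, smul_eq_mul, smul_eq_mul, dotProduct_comm]; ring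
    have hc : 0 < (Real.sqrt 2)⁻¹ * t := mul_pos (inv_pos.2 hs2p) ht
    rw [e1, e2] at h1
    exact le_of_mul_le_mul_left h1 hc
  -- conclusions
  have hnum1 : 2 * Real.sqrt (2 / 3) * (Real.sqrt 3)⁻¹ = (Real.sqrt 2)⁻¹ * (4 / 3) := by
    rw [h23]; field_simp; nlinarith [hs2, hs3]
  have hnum2 : 2 * Real.sqrt (2 / 3) * (Real.sqrt 2)⁻¹ = 2 * (Real.sqrt 3)⁻¹ := by
    rw [h23]; field_simp
  have hc1 : cubicCoords (A.symm (twinFrame F p (bestCapper (twinFrame F p) p z))) =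
      (Real.sqrt 2)⁻¹ • ((4 / 3 : ℝ) • P - Ys) := by
    rw [hF'q, κsub, κsmul, hP, hYs_def, smul_smul, hnum1, smul_sub, smul_smul]
  refine ⟨Ys, hYsT, hle, hc1, ?_⟩
  rw [κsub, κsmul, hc1, hP, smul_smul, hnum2]
  module


/-- **Level `k + 1` from level `k`, with ties**: the next numerators are `((4/3)P − Ys, (5/3)P − 2Ys)` for some `Zc`-lowest member
`Ys` of the rising triple of level `k`. -/
theorem forcedTop_succ_cubic_weak (A : EuclideanSpace ℝ (Fin 3) ≃ₗᵢ[ℝ] EuclideanSpace ℝ (Fin 3))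
    {u n z : EuclideanSpace ℝ (Fin 3)} {Zc : Fin 3 → ℝ} {t : ℝ} (hn : ‖n‖ = 1)
    (hmenu : ∀ w ∈ fccSlots, ⟪A w, n⟫_ℝ = 0 ∨ ⟪A w, n⟫_ℝ = Real.sqrt (2 / 3) ∨ ⟪A w, n⟫_ℝ = -Real.sqrt (2 / 3))
    (hZ : cubicCoords (A.symm z) = t • Zc) (ht : 0 < t) (k : ℕ) {X P : Fin 3 → ℝ}
    (hX : cubicCoords (A.symm ((forcedTop z ⟨A, u, 0⟩ n k).frame (forcedTop z ⟨A, u, 0⟩ n k).dir)) = (Real.sqrt 2)⁻¹ • X)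
    (hP : cubicCoords (A.symm (nextNormal (forcedTop z ⟨A, u, 0⟩ n k))) = (Real.sqrt 3)⁻¹ • P) :
    ∃ Ys : Fin 3 → ℝ, (Ys = X ∨ Ys = (1 / 2 : ℝ) • (-X + P ⨯₃ X + (2 : ℝ) • P) ∨ Ys = (1 / 2 : ℝ) • (-X - P ⨯₃ X + (2 : ℝ) • P)) ∧
      (∀ Y : Fin 3 → ℝ, (Y = X ∨ Y = (1 / 2 : ℝ) • (-X + P ⨯₃ X + (2 : ℝ) • P) ∨
        Y = (1 / 2 : ℝ) • (-X - P ⨯₃ X + (2 : ℝ) • P)) → Zc ⬝ᵥ Ys ≤ Zc ⬝ᵥ Y) ∧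
      cubicCoords (A.symm ((forcedTop z ⟨A, u, 0⟩ n (k + 1)).frame (forcedTop z ⟨A, u, 0⟩ n (k + 1)).dir)) =
        (Real.sqrt 2)⁻¹ • ((4 / 3 : ℝ) • P - Ys) ∧
      cubicCoords (A.symm (nextNormal (forcedTop z ⟨A, u, 0⟩ n (k + 1)))) =
        (Real.sqrt 3)⁻¹ • ((5 / 3 : ℝ) • P - (2 : ℝ) • Ys) := by
  set e := forcedTop z ⟨A, u, 0⟩ n k with he
  obtain ⟨hν, hmenuk, -⟩ := forcedTop_chain_invariant z A u hn hmenu k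
  rw [← he] at hν hmenuk
  obtain ⟨hd, hdpos⟩ := forcedTop_dir_mem_pos (z := z) (b := ⟨A, u, 0⟩) (n := n) (k := k) hν hmenuk
  rw [← he] at hd hdpos
  obtain ⟨hN1, hNmenu⟩ := nextNormal_unit_menu (forcedTop_dir z ⟨A, u, 0⟩ n k) hν hmenuk
  rw [← he] at hN1 hNmenu
  have hNpos : ⟪e.frame e.dir, nextNormal e⟫_ℝ = Real.sqrt (2 / 3) := by
    have hdd : ⟪e.frame e.dir, e.frame e.dir⟫_ℝ = 1 := by
      rw [LinearIsometryEquiv.inner_map_map, real_inner_self_eq_norm_sq, norm_eq_one_of_mem_fccSlots hd, one_pow]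
    show ⟪e.frame e.dir, (2 * Real.sqrt (2 / 3)) • e.frame e.dir - e.nrm⟫_ℝ = Real.sqrt (2 / 3)
    rw [inner_sub_right, real_inner_smul_right, hdd, hdpos]; ring
  obtain ⟨Ys, hYs, hle, h1, h2⟩ := ray_push_cubic_weak A e.frame hd hN1 hNmenu hNpos hX hP hZ ht
  have hfr : (forcedTop z ⟨A, u, 0⟩ n (k + 1)).frame = twinFrame e.frame (nextNormal e) := rfl
  have hdr : (forcedTop z ⟨A, u, 0⟩ n (k + 1)).dir = bestCapper (twinFrame e.frame (nextNormal e)) (nextNormal e) z := rfl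
  have hnr : (forcedTop z ⟨A, u, 0⟩ n (k + 1)).nrm = nextNormal e := rfl
  refine ⟨Ys, hYs, hle, by rw [hfr, hdr]; exact h1, ?_⟩
  rw [nextNormal, hfr, hdr, hnr]
  exact h2

/-- **Level `0` from the bottom, with ties.** -/
theorem forcedTop_zero_cubic_weak (A : EuclideanSpace ℝ (Fin 3) ≃ₗᵢ[ℝ] EuclideanSpace ℝ (Fin 3))
    {u n z : EuclideanSpace ℝ (Fin 3)} {Zc : Fin 3 → ℝ} {t : ℝ} (hu : u ∈ fccSlots) (hn : ‖n‖ = 1)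
    (hmenu : ∀ w ∈ fccSlots, ⟪A w, n⟫_ℝ = 0 ∨ ⟪A w, n⟫_ℝ = Real.sqrt (2 / 3) ∨ ⟪A w, n⟫_ℝ = -Real.sqrt (2 / 3))
    (hpos : ⟪A u, n⟫_ℝ = Real.sqrt (2 / 3))
    (hZ : cubicCoords (A.symm z) = t • Zc) (ht : 0 < t) {X P : Fin 3 → ℝ}
    (hX : cubicCoords u = (Real.sqrt 2)⁻¹ • X) (hP : cubicCoords (A.symm n) = (Real.sqrt 3)⁻¹ • P) :
    ∃ Ys : Fin 3 → ℝ, (Ys = X ∨ Ys = (1 / 2 : ℝ) • (-X + P ⨯₃ X + (2 : ℝ) • P) ∨ Ys = (1 / 2 : ℝ) • (-X - P ⨯₃ X + (2 : ℝ) • P)) ∧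
      (∀ Y : Fin 3 → ℝ, (Y = X ∨ Y = (1 / 2 : ℝ) • (-X + P ⨯₃ X + (2 : ℝ) • P) ∨
        Y = (1 / 2 : ℝ) • (-X - P ⨯₃ X + (2 : ℝ) • P)) → Zc ⬝ᵥ Ys ≤ Zc ⬝ᵥ Y) ∧
      cubicCoords (A.symm ((forcedTop z ⟨A, u, 0⟩ n 0).frame (forcedTop z ⟨A, u, 0⟩ n 0).dir)) =
        (Real.sqrt 2)⁻¹ • ((4 / 3 : ℝ) • P - Ys) ∧
      cubicCoords (A.symm (nextNormal (forcedTop z ⟨A, u, 0⟩ n 0))) =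
        (Real.sqrt 3)⁻¹ • ((5 / 3 : ℝ) • P - (2 : ℝ) • Ys) := by
  have hX' : cubicCoords (A.symm (A u)) = (Real.sqrt 2)⁻¹ • X := by rw [A.symm_apply_apply]; exact hX
  exact ray_push_cubic_weak A A hu hn hmenu hpos hX' hP hZ ht

end Summit.Ventures.Crystal3D.Theorems

end
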